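import Literature.Analysis.Distribution.HormanderEstimates
import HarnessLib

/-!
# Hörmander's bracket condition: the Lie algebra of iterated brackets and its germ `C^∞`-module

Topic `Literature/Analysis/Distribution`. Generic tools for VERIFYING the bracket condition
`Literature.Analysis.Distribution.IsBracketGenerating` of Hörmander's Theorem 1.1
(`Hypoelliptic.lean`) for concrete families of vector fields `X : κ → E → E` whose
non-degeneracy is only POINTWISE (the order of the first non-vanishing derivative of a
coefficient depends on the point), as in Rey-Bellet–Thomas 2002, Prop. 4.1 (condition **H2**:
"for each `q` there is `m = m(q) ≥ 2` with `∂^m U⁽²⁾(q) ≠ 0`") and Cuneo–Eckmann–Hairer–Rey-Bellet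
2018, Prop. 4.1 (condition C2). The printed proofs freely use three closure properties of "the
Lie algebra generated by the `X_i`" which the bare definition (values at `x` of the
right-nested iterated brackets `[X_{i₁}, [X_{i₂}, …, X_{i_k}]…]`) does not display:

* `lieSpan X` — the `ℝ`-span, inside the space of vector fields `E → E`, of the right-nested
  iterated brackets. It is closed under the bracket of ANY two of its elements
  (`lieBracket_mem_lieSpan`): right-nested brackets span the generated Lie algebra, by the
  Jacobi identity (Mathlib's `VectorField.leibniz_identity_lieBracket`) and induction on the
  length of the left factor (`IsIteratedLieBracket.lieBracket_mem_lieSpan`).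
* `InGermModule X x₀` — the germs at `x₀` of the `C^∞`-MODULE generated by `lieSpan X`: sums,
  products by functions smooth near `x₀`, and vector fields agreeing near `x₀` with such. It is
  closed under Lie brackets (`InGermModule.lieBracket`, from the Leibniz rules
  `[fV, W] = f[V, W] - (W·∇f) V`, `[V, fW] = f[V, W] + (V·∇f) W` and locality of the bracket), and
  the value at `x₀` of each of its members lies in the span of the values at `x₀` of the iterated
  brackets (`InGermModule.apply_mem`) — so one may divide by a coefficient that does not vanish
  AT `x₀` (`InGermModule.of_smul_of_ne_zero`) and still conclude about Hörmander's span at `x₀`.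
* `bracketSpanAt_eq_top_of_inGermModule` — if every vector of a spanning set, viewed as a
  constant vector field, is in the germ module at `x₀`, the bracket condition holds at `x₀`.

All vector fields of the family are assumed smooth (`∀ i, ContDiff ℝ ∞ (X i)`); smoothness of the
iterated brackets is `IsIteratedLieBracket.contDiff` of `HormanderEstimates.lean`.

## References

* L. Hörmander, *Hypoelliptic second order differential equations*, Acta Math. **119** (1967)
  147–171, Thm 1.1 (the bracket condition).
* L. Rey-Bellet, L. E. Thomas, Comm. Math. Phys. **225** (2002) 305–329, Prop. 4.1 (proof:
  "we need to consider further the commutators `[∂_{q₁}, [ …, [∂_{q₁}, ∑ ∂²U⁽²⁾ ∂_{p₂}]]]` …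
  we can write `∂_{p₂}` as a linear combination of these commutators for every `x`").
-/

noncomputable section

open Set Filter VectorField
open scoped ContDiff Topology

namespace Literature.Analysis.Distribution

variable {E : Type*} [NormedAddCommGroup E] [NormedSpace ℝ E] {κ : Type*} {X : κ → E → E}

/-! ### The `ℝ`-span of the iterated brackets -/

variable (X) in
/-- The `ℝ`-linear span, in the space of vector fields, of the right-nested iterated Lie
brackets `X_i`, `[X_{i₁}, [X_{i₂}, …, X_{i_k}]…]` of the family `X` (it is the Lie algebra of
vector fields generated by the family, `lieBracket_mem_lieSpan`). [folklore] -/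
def lieSpan : Submodule ℝ (E → E) :=
  Submodule.span ℝ {V | IsIteratedLieBracket X V}

variable (X) in
/-- The span of the values at `x` of the iterated brackets of the family `X` — the subspace
that Hörmander's bracket condition `IsBracketGenerating` requires to be everything.
[cite: Hormander1967, Thm 1.1] -/
def bracketSpanAt (x : E) : Submodule ℝ E :=
  Submodule.span ℝ {v | ∃ V : E → E, IsIteratedLieBracket X V ∧ V x = v}

/-- Unfolding `IsBracketGenerating` in terms of `bracketSpanAt`. [folklore] -/
theorem isBracketGenerating_iff (s : Set E) :
    IsBracketGenerating X s ↔ ∀ x ∈ s, bracketSpanAt X x = ⊤ := Iff.rfl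

/-- Members of the family are iterated brackets, hence in `lieSpan`. [folklore] -/
theorem mem_lieSpan_of (i : κ) : X i ∈ lieSpan X :=
  Submodule.subset_span (IsIteratedLieBracket.of i)

/-- Iterated brackets are in `lieSpan`. [folklore] -/
theorem IsIteratedLieBracket.mem_lieSpan {V : E → E} (hV : IsIteratedLieBracket X V) :
    V ∈ lieSpan X :=
  Submodule.subset_span hV

/-- Elements of `lieSpan` of a smooth family are smooth. [folklore] -/
theorem contDiff_of_mem_lieSpan (hX : ∀ i, ContDiff ℝ ∞ (X i)) {V : E → E}
    (hV : V ∈ lieSpan X) : ContDiff ℝ ∞ V := by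
  induction hV using Submodule.span_induction with
  | mem V hV => exact hV.contDiff hX
  | zero => exact contDiff_const
  | add V W _ _ hV hW => exact hV.add hW
  | smul c V _ hV => exact hV.const_smul c

/-- The value at `x` of an element of `lieSpan` lies in `bracketSpanAt x`. [folklore] -/
theorem apply_mem_bracketSpanAt {V : E → E} (hV : V ∈ lieSpan X) (x : E) :
    V x ∈ bracketSpanAt X x := by
  induction hV using Submodule.span_induction with
  | mem V hV => exact Submodule.subset_span ⟨V, hV, rfl⟩
  | zero => exact Submodule.zero_mem _
  | add V W _ _ hV hW => exact Submodule.add_mem _ hV hW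
  | smul c V _ hV => exact Submodule.smul_mem _ c hV

/-- `lieSpan` is stable under bracketing with a member of the family (bilinearity of the
bracket). [folklore] -/
theorem lieBracket_family_mem_lieSpan (hX : ∀ i, ContDiff ℝ ∞ (X i)) (i : κ) {V : E → E}
    (hV : V ∈ lieSpan X) : lieBracket ℝ (X i) V ∈ lieSpan X := by
  induction hV using Submodule.span_induction with
  | mem V hV => exact (IsIteratedLieBracket.lieBracket i hV).mem_lieSpan
  | zero => rw [lieBracket_zero_right]; exact Submodule.zero_mem _
  | add V W hV hW ihV ihW =>
    have hVd := (contDiff_of_mem_lieSpan hX hV).differentiable (by simp)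
    have hWd := (contDiff_of_mem_lieSpan hX hW).differentiable (by simp)
    have e : lieBracket ℝ (X i) (V + W) = lieBracket ℝ (X i) V + lieBracket ℝ (X i) W := by
      funext y
      exact lieBracket_add_right (hVd y) (hWd y)
    rw [e]
    exact Submodule.add_mem _ ihV ihW
  | smul c V hV ihV =>
    have hVd := (contDiff_of_mem_lieSpan hX hV).differentiable (by simp)
    have e : lieBracket ℝ (X i) (c • V) = c • lieBracket ℝ (X i) V := by
      funext y
      exact lieBracket_const_smul_right (hVd y)
    rw [e]
    exact Submodule.smul_mem _ c ihV

/-- **Right-nested brackets span the generated Lie algebra**: the bracket of an iterated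
bracket `U` with any element of `lieSpan` is again in `lieSpan` — by induction on `U`, the Jacobi
identity `[[X_i, U'], V] = [X_i, [U', V]] - [U', [X_i, V]]` reducing the length of the left
factor. [folklore] -/
theorem IsIteratedLieBracket.lieBracket_mem_lieSpan (hX : ∀ i, ContDiff ℝ ∞ (X i)) {U : E → E}
    (hU : IsIteratedLieBracket X U) : ∀ {V : E → E}, V ∈ lieSpan X → VectorField.lieBracket ℝ U V ∈ lieSpan X := by
  induction hU with
  | of i => exact fun hV => lieBracket_family_mem_lieSpan hX i hV
  | lieBracket i hU' ih =>
    intro V hV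
    rename_i U'
    have hXi : ContDiff ℝ ∞ (X i) := hX i
    have hU'c : ContDiff ℝ ∞ U' := hU'.contDiff hX
    have hVc : ContDiff ℝ ∞ V := contDiff_of_mem_lieSpan hX hV
    have e : VectorField.lieBracket ℝ (VectorField.lieBracket ℝ (X i) U') V =
        VectorField.lieBracket ℝ (X i) (VectorField.lieBracket ℝ U' V) - VectorField.lieBracket ℝ U' (VectorField.lieBracket ℝ (X i) V) := by
      funext y
      have h := leibniz_identity_lieBracket (𝕜 := ℝ) (n := ∞)
        (by rw [minSmoothness_of_isRCLikeNormedField]; exact WithTop.coe_le_coe.2 le_top) hXi.contDiffAt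
        hU'c.contDiffAt hVc.contDiffAt (U := X i) (V := U') (W := V) (x := y)
      rw [Pi.sub_apply]
      exact eq_sub_of_add_eq h.symm
    rw [e]
    exact Submodule.sub_mem _ (lieBracket_family_mem_lieSpan hX i (ih hV))
      (ih (lieBracket_family_mem_lieSpan hX i hV))

/-- **`lieSpan` is a Lie algebra of vector fields**: it is closed under the bracket.
[folklore] -/
theorem lieBracket_mem_lieSpan (hX : ∀ i, ContDiff ℝ ∞ (X i)) {U V : E → E}
    (hU : U ∈ lieSpan X) (hV : V ∈ lieSpan X) : lieBracket ℝ U V ∈ lieSpan X := by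
  induction hU using Submodule.span_induction with
  | mem U hU => exact hU.lieBracket_mem_lieSpan hX hV
  | zero => rw [lieBracket_zero_left]; exact Submodule.zero_mem _
  | add U W hU hW ihU ihW =>
    have hUd := (contDiff_of_mem_lieSpan hX hU).differentiable (by simp)
    have hWd := (contDiff_of_mem_lieSpan hX hW).differentiable (by simp)
    have e : lieBracket ℝ (U + W) V = lieBracket ℝ U V + lieBracket ℝ W V := by
      funext y
      exact lieBracket_add_left (hUd y) (hWd y)
    rw [e]
    exact Submodule.add_mem _ ihU ihW
  | smul c U hU ihU =>
    have hUd := (contDiff_of_mem_lieSpan hX hU).differentiable (by simp)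
    have e : lieBracket ℝ (c • U) V = c • lieBracket ℝ U V := by
      funext y
      exact lieBracket_const_smul_left (hUd y)
    rw [e]
    exact Submodule.smul_mem _ c ihU

/-! ### The germ `C^∞`-module at a point -/

variable (X) in
/-- **The germ at `x₀` of the `C^∞`-module generated by the iterated brackets.** The smallest
class of vector fields containing `lieSpan X`, closed under sums, under multiplication by real
functions that are smooth at every point near `x₀`, and under replacing a field by one that
agrees with it near `x₀`. [folklore] -/
inductive InGermModule (x₀ : E) : (E → E) → Prop
  | mem {V : E → E} (hV : V ∈ lieSpan X) : InGermModule x₀ V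
  | add {V W : E → E} : InGermModule x₀ V → InGermModule x₀ W → InGermModule x₀ (V + W)
  | smul {f : E → ℝ} {V : E → E} (hf : ∀ᶠ y in 𝓝 x₀, ContDiffAt ℝ ∞ f y) :
      InGermModule x₀ V → InGermModule x₀ (fun y => f y • V y)
  | congr {V W : E → E} : InGermModule x₀ V → W =ᶠ[𝓝 x₀] V → InGermModule x₀ W

namespace InGermModule

variable {x₀ : E}

/-- The zero field is in the germ module. [folklore] -/
theorem zero : InGermModule X x₀ 0 := mem (Submodule.zero_mem _)

/-- Constant multiples stay in the germ module. [folklore] -/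
theorem const_smul (c : ℝ) {V : E → E} (hV : InGermModule X x₀ V) : InGermModule X x₀ (c • V) := by
  have h := smul (f := fun _ => c) (Eventually.of_forall fun _ => contDiffAt_const) hV
  exact h

/-- Negatives stay in the germ module. [folklore] -/
theorem neg {V : E → E} (hV : InGermModule X x₀ V) : InGermModule X x₀ (-V) := by
  have h := hV.const_smul (-1)
  rwa [neg_one_smul] at h

/-- Differences stay in the germ module. [folklore] -/
theorem sub {V W : E → E} (hV : InGermModule X x₀ V) (hW : InGermModule X x₀ W) :
    InGermModule X x₀ (V - W) := by
  rw [sub_eq_add_neg]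
  exact hV.add hW.neg

/-- Finite sums stay in the germ module. [folklore] -/
theorem finset_sum {ι : Type*} (s : Finset ι) {F : ι → E → E}
    (h : ∀ i ∈ s, InGermModule X x₀ (F i)) : InGermModule X x₀ (∑ i ∈ s, F i) := by
  classical
  induction s using Finset.induction_on with
  | empty => rw [Finset.sum_empty]; exact zero
  | insert a s ha ih =>
    rw [Finset.sum_insert ha]
    exact (h a (Finset.mem_insert_self a s)).add (ih fun i hi => h i (Finset.mem_insert_of_mem hi))

/-- Members of the germ module are smooth at every point near `x₀`. [folklore] -/
theorem eventually_contDiffAt (hX : ∀ i, ContDiff ℝ ∞ (X i)) {V : E → E}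
    (hV : InGermModule X x₀ V) : ∀ᶠ y in 𝓝 x₀, ContDiffAt ℝ ∞ V y := by
  induction hV with
  | mem hV => exact Eventually.of_forall fun y => (contDiff_of_mem_lieSpan hX hV).contDiffAt
  | add _ _ ihV ihW => exact (ihV.and ihW).mono fun y h => h.1.add h.2
  | smul hf _ ih => exact (hf.and ih).mono fun y h => h.1.smul h.2
  | congr _ hWV ih =>
    exact (ih.and hWV.eventuallyEq_nhds).mono fun y h => h.1.congr_of_eventuallyEq h.2

/-- **Values at `x₀` of the germ module lie in Hörmander's span at `x₀`.** [folklore] -/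
theorem apply_mem {V : E → E} (hV : InGermModule X x₀ V) : V x₀ ∈ bracketSpanAt X x₀ := by
  induction hV with
  | mem hV => exact apply_mem_bracketSpanAt hV x₀
  | add _ _ ihV ihW => exact Submodule.add_mem _ ihV ihW
  | smul _ _ ih => exact Submodule.smul_mem _ _ ih
  | congr _ hWV ih => rw [show _ = _ from hWV.self_of_nhds]; exact ih

/-- The germ module is stable under bracketing with an element of `lieSpan` on the left.
[folklore] -/
theorem lieBracket_right (hX : ∀ i, ContDiff ℝ ∞ (X i)) {U : E → E} (hU : U ∈ lieSpan X)
    {W : E → E} (hW : InGermModule X x₀ W) : InGermModule X x₀ (lieBracket ℝ U W) := by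
  have hUc : ContDiff ℝ ∞ U := contDiff_of_mem_lieSpan hX hU
  induction hW with
  | mem hW => exact mem (lieBracket_mem_lieSpan hX hU hW)
  | add hV hW ihV ihW =>
    rename_i V W
    refine congr (ihV.add ihW) ?_
    filter_upwards [hV.eventually_contDiffAt hX, hW.eventually_contDiffAt hX] with y h1 h2
    exact lieBracket_add_right (h1.differentiableAt (by simp)) (h2.differentiableAt (by simp))
  | smul hf hV ih =>
    rename_i f V
    -- `[U, fV] = (U·∇f) V + f [U, V]`
    have hg : ∀ᶠ y in 𝓝 x₀, ContDiffAt ℝ ∞ (fun y => fderiv ℝ f y (U y)) y :=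
      hf.mono fun y h =>
        (h.fderiv_right (m := ∞) (by exact_mod_cast le_top)).clm_apply hUc.contDiffAt
    refine congr ((smul hg hV).add (smul hf ih)) ?_
    filter_upwards [hf, hV.eventually_contDiffAt hX] with y h1 h2
    rw [Pi.add_apply]
    exact lieBracket_smul_right (h1.differentiableAt (by simp)) (h2.differentiableAt (by simp))
  | congr hV hWV ih =>
    exact congr ih ((EventuallyEq.refl _ U).lieBracket_vectorField hWV)

/-- **The germ module is closed under the Lie bracket.** [folklore] -/
theorem lieBracket (hX : ∀ i, ContDiff ℝ ∞ (X i)) {V W : E → E} (hV : InGermModule X x₀ V)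
    (hW : InGermModule X x₀ W) : InGermModule X x₀ (VectorField.lieBracket ℝ V W) := by
  induction hV with
  | mem hV => exact hW.lieBracket_right hX hV
  | add hV₁ hV₂ ih₁ ih₂ =>
    rename_i V₁ V₂
    refine congr (ih₁.add ih₂) ?_
    filter_upwards [hV₁.eventually_contDiffAt hX, hV₂.eventually_contDiffAt hX] with y h1 h2
    exact lieBracket_add_left (h1.differentiableAt (by simp)) (h2.differentiableAt (by simp))
  | smul hf hV ih =>
    rename_i f V
    -- `[fV, W] = -(W·∇f) V + f [V, W]`
    have hg : ∀ᶠ y in 𝓝 x₀, ContDiffAt ℝ ∞ (fun y => -(fderiv ℝ f y (W y))) y := by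
      filter_upwards [hf, hW.eventually_contDiffAt hX] with y h1 h2
      exact ((h1.fderiv_right (m := ∞) (by exact_mod_cast le_top)).clm_apply h2).neg
    refine congr ((smul hg hV).add (smul hf ih)) ?_
    filter_upwards [hf, hV.eventually_contDiffAt hX] with y h1 h2
    rw [Pi.add_apply, lieBracket_smul_left (h1.differentiableAt (by simp))
      (h2.differentiableAt (by simp)), neg_smul]
  | congr hV hWV ih =>
    exact congr ih (hWV.lieBracket_vectorField (EventuallyEq.refl _ W))

/-- **Division by a coefficient non-vanishing at `x₀`**: if `c` is smooth near `x₀`,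
`c x₀ ≠ 0`, and the field `y ↦ c y • V y` is in the germ module, then so is `V` (multiply by
`1/c`, smooth near `x₀`). [folklore] -/
theorem of_smul_of_ne_zero {c : E → ℝ} {V : E → E}
    (hc : ∀ᶠ y in 𝓝 x₀, ContDiffAt ℝ ∞ c y) (hc0 : c x₀ ≠ 0)
    (hV : InGermModule X x₀ (fun y => c y • V y)) : InGermModule X x₀ V := by
  have hcont : ContinuousAt c x₀ := hc.self_of_nhds.continuousAt
  have hne : ∀ᶠ y in 𝓝 x₀, c y ≠ 0 := hcont.eventually_ne hc0
  have hinv : ∀ᶠ y in 𝓝 x₀, ContDiffAt ℝ ∞ (fun y => (c y)⁻¹) y := by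
    filter_upwards [hc, hne] with y h1 h2
    exact h1.inv h2
  refine congr (smul hinv hV) ?_
  filter_upwards [hne] with y hy
  simp [smul_smul, inv_mul_cancel₀ hy]

end InGermModule

/-- **The bracket condition at `x₀` from the germ module**: if every vector of a set spanning
`E`, viewed as a constant vector field, belongs to the germ module at `x₀`, then the values at
`x₀` of the iterated brackets span `E`. [folklore] -/
theorem bracketSpanAt_eq_top_of_inGermModule {x₀ : E} {S : Set E}
    (hS : Submodule.span ℝ S = ⊤) (h : ∀ v ∈ S, InGermModule X x₀ (fun _ => v)) :
    bracketSpanAt X x₀ = ⊤ := by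
  rw [eq_top_iff, ← hS, Submodule.span_le]
  intro v hv
  exact (h v hv).apply_mem

/-! ### Constant vector fields -/

/-- The bracket of a constant field `v` with `W` is the directional derivative `DW·v`.
[folklore] -/
theorem lieBracket_const_left (v : E) (W : E → E) :
    lieBracket ℝ (fun _ => v) W = fun y => fderiv ℝ W y v := by
  funext y
  simp [lieBracket]

/-- `[v, f w] = (Df·v) w` for constant vectors `v, w` and a function `f` differentiable at the
point. [folklore] -/
theorem lieBracket_const_smul_const {f : E → ℝ} (v w : E) {y : E}
    (hf : DifferentiableAt ℝ f y) :
    lieBracket ℝ (fun _ => v) (fun z => f z • w) y = (fderiv ℝ f y v) • w := by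
  rw [lieBracket_const_left]
  simp only
  rw [fderiv_smul_const hf, ContinuousLinearMap.smulRight_apply]

end Literature.Analysis.Distribution
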